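import Summits.QuantumFields.YangMills.Theorems.BalabanUVNodesPortS1Sect4WardPackageSU2
import Summits.QuantumFields.YangMills.Theorems.BalabanUVNodesPortS1Sect5AtRecordF1Pkg

/-!
# NODE O port, row PT-A-2 S4 — THE ONE-NAME §4 PACKAGE: (4.15)₂, p. 289 `Ad`-invariance, (4.15)₃, (4.29) EXACT, (4.31) EXACT and the (4.32)–(4.34) scalar-kernel Hessian UNDER ONE
# TRANSPORT `eV : V ≃ 𝔰𝔲(2)` (so the brackets of the five identities are THE SAME object), generic over any `SU(2)`-gauge-invariant unit-lattice functional, then AT THE RE-CENTRED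
# RECORD (i) from the raw rows `C⁴ at 0` + `hN`, (ii) from FORMAT⁺ᴳ at level `k` + token [12] (FILE `…Sect4ChartSmooth`) + the free-radius domain rows `νD` (FILE `…Sect5OnDomainF1Perm`)

CITATION HEADER.  [I] = [Balaban1987RG1]: (4.7) p. 282, (4.15) p. 284, (4.21)–(4.31) pp. 285–289, (4.32)–(4.34) p. 289, (1.19) p. 263, (2.16) p. 269; [B11] = [Balaban1985Variational] Thm 1
p. 279.  Porter PT-A-2 (`ymgap-nodeO-port-PTA-2`), `--supports stmt-QuantumFields-27930 --as helper`.  REUSED BY NAME: `exists_lieEquiv_su_of_suChart`, `exists_ambient_extension`, the lineage's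
`third_chart_apply_grad_eq_zero_of_isSemisimple ∕ hessian_chart_ad_invariant_of_isSemisimple ∕ fourth_chart_apply_grad_eq_zero_of_bracket ∕ eq429_chart_of_isSemisimple ∕ eq431_chart_of_isSemisimple ∕
hessian_chart_eq_sum_scalar_kernel_killing`, `eventually_plaqSmall_readField`, `contDiffAt_expChart_recordTermsAx_of_formatPlusG`, `mergedTermT_gaugeAct_recordAx_of_rows'`.
WHAT IS PROVED (0 sorry, 0 def): ★★ `wardPackage_of_suGaugeInvariant` (generic, ONE `eV`, six conjuncts); `suGaugeInvariant_recordTermsAx_of_hN` (the record's `hN` row ⟹ the generic `SU(2)`-invariance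
shape for `ℰ := recordTermsAx … K`); ★★★ `sect4_recordTermsAx_package` (the six identities at the record under one `eV`, from `C⁴ at 0` + `hN`); ★★★ `sect4_recordTermsAx_of_formatPlusG_rows'`
(the same from FORMAT⁺ᴳ(k) + [12] + the `νD`-rows at the volume `recordK₀ F Mc k + n`).
HONEST FRAMING.  Packaging of landed identities; nothing of Bałaban's estimates asserted, ported or discharged; no bound, no irrelevance, no (4.34) table; 27930 signed-open (⁸-Ax-LR4), no claim held;
finite 𝕋⁴ at fixed ε — NOT continuum∕OS∕Clay; the Yang–Mills mass gap is NOT proved by any of this.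
-/

noncomputable section

open scoped Matrix.Norms.L2Operator Topology

namespace Summit.QuantumFields.YangMills.Theorems.BalabanUVNodesPortS1

open Filter Matrix MeasureTheory
open NormedSpace (exp)
open Literature.Algebra.Lie.CompactKillingForm (su mem_su_iff)
open Literature.MathematicalPhysics.QuantumFieldTheory.Balaban1983to89
open Literature.MathematicalPhysics.QuantumFieldTheory.Balaban1983to89.B12PolarizationTensor120 (expChart expChart_apply)
open Literature.MathematicalPhysics.QuantumFieldTheory.Balaban1983to89.B12WardSecond415 (third_chart_apply_grad_eq_zero_of_isSemisimple hessian_chart_ad_invariant_of_isSemisimple)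
open Literature.MathematicalPhysics.QuantumFieldTheory.Balaban1983to89.B12WardThird415 (fourth_chart_apply_grad_eq_zero_of_bracket)
open Literature.MathematicalPhysics.QuantumFieldTheory.Balaban1983to89.B12WTReduction429 (eq429_chart_of_isSemisimple eq431_chart_of_isSemisimple)

/-! ## §1 Generic: the six identities under ONE transport `eV` -/

section Generic

variable {V : Type*} [NormedAddCommGroup V] [NormedSpace ℝ V] {Λ T : Type*} [Fintype Λ] [Fintype T] [AddCommGroup T] [DecidableEq Λ] [DecidableEq T]
  {F : Type*} [NormedAddCommGroup F] [NormedSpace ℝ F]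

-- (the quadruply nested operator space over the iterated `Pi` type: one more level of pending instance synthesis)
set_option maxSynthPendingDepth 3 in
/-- **★★ THE §4 WARD PACKAGE UNDER ONE `eV`, FOR ANY `SU(2)`-GAUGE-INVARIANT FUNCTIONAL** (`C⁴` at `0` of `f = expChart ℰ ρ`; `ℰ(V^g) = ℰ(V)` for `SU(2)`-valued `V` near `1`, `SU(2)`-valued `g`):
there is `eV : V ≃ 𝔰𝔲(2)` with `↑(eV a) = ρ a` and `ρ(eV⁻¹⁅eV a, eV b⁆) = ρa ρb − ρb ρa` such that, with ALL brackets `[a, b] := eV⁻¹⁅eV a, eV b⁆`: (4.15)₂; p. 289 `D²f(0)(u,[l,w]) + D²f(0)(w,[l,u]) = 0`;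
(4.15)₃ (`k₂ = 1∕12`); (4.29) EXACT (pointwise in `x`, eleven explicit remainder terms); (4.31) EXACT (six remainder terms); and `D²f(0)(u, w) = Σ κ(eV u_μ(x), eV w_ν(y))·E_{μν}(x,y)` for one
scalar kernel `E`. [cite: Balaban1987RG1, (4.15) p.284, (4.29) p.288, (4.31) p.289, (4.32)-(4.34) p.289, (4.7) p.282] -/
theorem wardPackage_of_suGaugeInvariant (ρ : V →L[ℝ] Matrix (Fin 2) (Fin 2) ℂ) (hinj : Function.Injective ρ)
    (hmem : ∀ x, (ρ x)ᴴ = -ρ x ∧ (ρ x).trace = 0) (honto : ∀ X : Matrix (Fin 2) (Fin 2) ℂ, Xᴴ = -X → X.trace = 0 → ∃ x, ρ x = X)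
    (ℰ : (Λ → T → Matrix (Fin 2) (Fin 2) ℂ) → F) (e : Λ → T) (hC4 : ContDiffAt ℝ 4 (expChart ℰ ρ) 0)
    (hGI : ∀ᶠ Vf in 𝓝 (1 : Λ → T → Matrix (Fin 2) (Fin 2) ℂ), (∀ ν x, Vf ν x ∈ Matrix.specialUnitaryGroup (Fin 2) ℂ) →
      ∀ g : T → Matrix (Fin 2) (Fin 2) ℂ, (∀ x, g x ∈ Matrix.specialUnitaryGroup (Fin 2) ℂ) → ℰ (fun ν x => g x * Vf ν x * star (g (x + e ν))) = ℰ Vf) :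
    ∃ eV : V ≃ₗ[ℝ] su (Fin 2), (∀ a, ((eV a : su (Fin 2)) : Matrix (Fin 2) (Fin 2) ℂ) = ρ a) ∧
      (∀ a b : V, ρ (eV.symm ⁅eV a, eV b⁆) = ρ a * ρ b - ρ b * ρ a) ∧
      -- (4.15)₂
      (∀ (u w : Λ → T → V) (lam : T → V),
        fderiv ℝ (fderiv ℝ (fderiv ℝ (expChart ℰ ρ))) 0 u w (fun ν y => lam (y + e ν) - lam y)
          - fderiv ℝ (fderiv ℝ (expChart ℰ ρ)) 0 u
              (fun ν x => eV.symm ⁅eV (lam x), eV (w ν x)⁆ - (2 : ℝ)⁻¹ • eV.symm ⁅eV (w ν x), eV (lam (x + e ν) - lam x)⁆)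
          - fderiv ℝ (fderiv ℝ (expChart ℰ ρ)) 0 w
              (fun ν x => eV.symm ⁅eV (lam x), eV (u ν x)⁆ - (2 : ℝ)⁻¹ • eV.symm ⁅eV (u ν x), eV (lam (x + e ν) - lam x)⁆) = 0) ∧
      -- p. 289 `Ad`-invariance
      (∀ (l : V) (u w : Λ → T → V),
        fderiv ℝ (fderiv ℝ (expChart ℰ ρ)) 0 u (fun ν x => eV.symm ⁅eV l, eV (w ν x)⁆) +
          fderiv ℝ (fderiv ℝ (expChart ℰ ρ)) 0 w (fun ν x => eV.symm ⁅eV l, eV (u ν x)⁆) = 0) ∧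
      -- (4.15)₃
      (∀ (u₁ u₂ u₃ : Λ → T → V) (lam : T → V),
        fderiv ℝ (fderiv ℝ (fderiv ℝ (fderiv ℝ (expChart ℰ ρ)))) 0 u₁ u₂ u₃ (fun ν y => lam (y + e ν) - lam y)
          - fderiv ℝ (fderiv ℝ (fderiv ℝ (expChart ℰ ρ))) 0 u₁ u₂
              (fun ν x => eV.symm ⁅eV (lam x), eV (u₃ ν x)⁆ - (2 : ℝ)⁻¹ • eV.symm ⁅eV (u₃ ν x), eV (lam (x + e ν) - lam x)⁆)
          - fderiv ℝ (fderiv ℝ (fderiv ℝ (expChart ℰ ρ))) 0 u₁ u₃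
              (fun ν x => eV.symm ⁅eV (lam x), eV (u₂ ν x)⁆ - (2 : ℝ)⁻¹ • eV.symm ⁅eV (u₂ ν x), eV (lam (x + e ν) - lam x)⁆)
          - fderiv ℝ (fderiv ℝ (fderiv ℝ (expChart ℰ ρ))) 0 u₂ u₃
              (fun ν x => eV.symm ⁅eV (lam x), eV (u₁ ν x)⁆ - (2 : ℝ)⁻¹ • eV.symm ⁅eV (u₁ ν x), eV (lam (x + e ν) - lam x)⁆)
          + fderiv ℝ (fderiv ℝ (expChart ℰ ρ)) 0 u₁
              (fun ν x => (12 : ℝ)⁻¹ • (eV.symm ⁅eV (u₂ ν x), eV (eV.symm ⁅eV (u₃ ν x), eV (lam (x + e ν) - lam x)⁆)⁆ +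
                eV.symm ⁅eV (u₃ ν x), eV (eV.symm ⁅eV (u₂ ν x), eV (lam (x + e ν) - lam x)⁆)⁆))
          + fderiv ℝ (fderiv ℝ (expChart ℰ ρ)) 0 u₂
              (fun ν x => (12 : ℝ)⁻¹ • (eV.symm ⁅eV (u₁ ν x), eV (eV.symm ⁅eV (u₃ ν x), eV (lam (x + e ν) - lam x)⁆)⁆ +
                eV.symm ⁅eV (u₃ ν x), eV (eV.symm ⁅eV (u₁ ν x), eV (lam (x + e ν) - lam x)⁆)⁆))
          + fderiv ℝ (fderiv ℝ (expChart ℰ ρ)) 0 u₃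
              (fun ν x => (12 : ℝ)⁻¹ • (eV.symm ⁅eV (u₁ ν x), eV (eV.symm ⁅eV (u₂ ν x), eV (lam (x + e ν) - lam x)⁆)⁆ +
                eV.symm ⁅eV (u₂ ν x), eV (eV.symm ⁅eV (u₁ ν x), eV (lam (x + e ν) - lam x)⁆)⁆)) = 0) ∧
      -- (4.29) EXACT
      (∀ (x : T) (lam : T → V), lam x = 0 → ∀ (δ c B : Λ → T → V),
        (∀ ν y, y ≠ x → δ ν y = 0) → (∀ ν y, lam (y + e ν) - lam y = c ν y) → (∀ ν, B ν x = c ν x) →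
        fderiv ℝ (fderiv ℝ (fderiv ℝ (fderiv ℝ (expChart ℰ ρ)))) 0 δ B B B =
          (2 : ℝ) • fderiv ℝ (fderiv ℝ (expChart ℰ ρ)) 0 δ (fun ν y => eV.symm ⁅eV (lam y), eV (eV.symm ⁅eV (lam y), eV (c ν y)⁆)⁆)
          - fderiv ℝ (fderiv ℝ (expChart ℰ ρ)) 0 δ (fun ν y => eV.symm ⁅eV (eV.symm ⁅eV (lam y), eV (c ν y)⁆), eV (c ν y)⁆)
          - (3 / 2 : ℝ) • fderiv ℝ (fderiv ℝ (expChart ℰ ρ)) 0 (fun ν y => eV.symm ⁅eV (δ ν y), eV (B ν y)⁆) (fun ν y => eV.symm ⁅eV (lam y), eV (c ν y)⁆)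
          + (fderiv ℝ (fderiv ℝ (fderiv ℝ (fderiv ℝ (expChart ℰ ρ)))) 0 δ B B (B - c)
            - (2 : ℝ) • fderiv ℝ (fderiv ℝ (expChart ℰ ρ)) 0
                (fun ν y => (12 : ℝ)⁻¹ • (eV.symm ⁅eV (B ν y), eV (eV.symm ⁅eV (δ ν y), eV (c ν y)⁆)⁆ + eV.symm ⁅eV (δ ν y), eV (eV.symm ⁅eV (B ν y), eV (c ν y)⁆)⁆)) (B - c)
            - (2 : ℝ) • fderiv ℝ (fderiv ℝ (expChart ℰ ρ)) 0 δ (fun ν y => (12 : ℝ)⁻¹ • eV.symm ⁅eV (B ν y), eV (eV.symm ⁅eV (B ν y - c ν y), eV (c ν y)⁆)⁆)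
            - (2 : ℝ)⁻¹ • fderiv ℝ (fderiv ℝ (fderiv ℝ (expChart ℰ ρ))) 0 (fun ν y => eV.symm ⁅eV (δ ν y), eV (B ν y)⁆) B (B - c)
            + (4 : ℝ)⁻¹ • fderiv ℝ (fderiv ℝ (expChart ℰ ρ)) 0 (fun ν y => eV.symm ⁅eV (δ ν y), eV (B ν y)⁆) (fun ν y => eV.symm ⁅eV (B ν y - c ν y), eV (c ν y)⁆)
            + (4 : ℝ)⁻¹ • fderiv ℝ (fderiv ℝ (expChart ℰ ρ)) 0 (fun ν y => eV.symm ⁅eV (eV.symm ⁅eV (δ ν y), eV (B ν y)⁆), eV (B ν y)⁆) (B - c)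
            - fderiv ℝ (fderiv ℝ (fderiv ℝ (expChart ℰ ρ))) 0 δ B (fun ν y => eV.symm ⁅eV (B ν y - c ν y), eV (c ν y)⁆)
            + (2 : ℝ) • fderiv ℝ (fderiv ℝ (fderiv ℝ (expChart ℰ ρ))) 0 δ (fun ν y => eV.symm ⁅eV (lam y), eV (B ν y)⁆) (B - c)
            + (2 : ℝ) • fderiv ℝ (fderiv ℝ (expChart ℰ ρ)) 0 δ (fun ν y => eV.symm ⁅eV (lam y), eV (eV.symm ⁅eV (lam y), eV (B ν y - c ν y)⁆)⁆)
            - fderiv ℝ (fderiv ℝ (expChart ℰ ρ)) 0 δ (fun ν y => eV.symm ⁅eV (eV.symm ⁅eV (lam y), eV (B ν y - c ν y)⁆), eV (c ν y)⁆)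
            - (3 / 2 : ℝ) • fderiv ℝ (fderiv ℝ (expChart ℰ ρ)) 0 (fun ν y => eV.symm ⁅eV (δ ν y), eV (B ν y)⁆) (fun ν y => eV.symm ⁅eV (lam y), eV (B ν y - c ν y)⁆))) ∧
      -- (4.31) EXACT
      (∀ (x : T) (lam : T → V), lam x = 0 → ∀ (δ c B ℓ : Λ → T → V),
        (∀ ν y, y ≠ x → δ ν y = 0) → (∀ ν y, lam (y + e ν) - lam y = c ν y) → (∀ ν, B ν x = c ν x) →
        fderiv ℝ (fderiv ℝ (fderiv ℝ (expChart ℰ ρ))) 0 δ B B =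
          fderiv ℝ (fderiv ℝ (expChart ℰ ρ)) 0 δ (fun ν y => eV.symm ⁅eV (lam y), eV (c ν y)⁆)
          + (2 : ℝ) • fderiv ℝ (fderiv ℝ (expChart ℰ ρ)) 0 δ (fun ν y => eV.symm ⁅eV (lam y), eV (ℓ ν y)⁆)
          - fderiv ℝ (fderiv ℝ (expChart ℰ ρ)) 0 δ (fun ν y => eV.symm ⁅eV (ℓ ν y), eV (c ν y)⁆)
          - fderiv ℝ (fderiv ℝ (expChart ℰ ρ)) 0 (fun ν y => eV.symm ⁅eV (δ ν y), eV (B ν y)⁆) ℓ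
          + (fderiv ℝ (fderiv ℝ (fderiv ℝ (expChart ℰ ρ))) 0 δ B (B - c - ℓ)
            + fderiv ℝ (fderiv ℝ (fderiv ℝ (expChart ℰ ρ))) 0 δ ℓ ℓ
            + fderiv ℝ (fderiv ℝ (fderiv ℝ (expChart ℰ ρ))) 0 δ (B - c - ℓ) ℓ
            - (2 : ℝ)⁻¹ • fderiv ℝ (fderiv ℝ (expChart ℰ ρ)) 0 (fun ν y => eV.symm ⁅eV (δ ν y), eV (B ν y)⁆) (B - c - ℓ)
            + fderiv ℝ (fderiv ℝ (expChart ℰ ρ)) 0 δ (fun ν y => eV.symm ⁅eV (lam y), eV (B ν y - c ν y - ℓ ν y)⁆)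
            - (2 : ℝ)⁻¹ • fderiv ℝ (fderiv ℝ (expChart ℰ ρ)) 0 δ (fun ν y => eV.symm ⁅eV (B ν y - c ν y - ℓ ν y), eV (c ν y)⁆))) ∧
      -- (4.32)–(4.34): one scalar kernel
      (∃ E : Λ → T → Λ → T → F, ∀ u w : Λ → T → V,
        fderiv ℝ (fderiv ℝ (expChart ℰ ρ)) 0 u w = ∑ μ, ∑ x, ∑ ν, ∑ y, killingForm ℝ (su (Fin 2)) (eV (u μ x)) (eV (w ν y)) • E μ x ν y) := by
  haveI := Literature.Algebra.Lie.SpecialUnitarySimple.isSimple_su (Fin 2) (by simp)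
  obtain ⟨eV, heV, hρ⟩ := exists_lieEquiv_su_of_suChart ρ hinj hmem honto
  obtain ⟨ℰ', h1, h2, h3⟩ := exists_ambient_extension ρ hinj hmem honto ℰ e
  have h47 : ∀ lam : T → V, ∀ᶠ W in 𝓝 (1 : Λ → T → Matrix (Fin 2) (Fin 2) ℂ), ∀ᶠ t in 𝓝 (0 : ℝ),
      ℰ' (fun ν x => exp (t • ρ (lam x)) * W ν x * exp (-(t • ρ (lam (x + e ν))))) = ℰ' W :=
    fun lam' => (h3 hGI lam').mono fun W hW => Filter.Eventually.of_forall fun t => hW t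
  have hC3 : ContDiffAt ℝ 3 ℰ' 1 := h2 3 (hC4.of_le (by norm_num))
  have hchart : (fun B : Λ → T → V => ℰ' (fun ν x => exp (ρ (B ν x)))) = expChart ℰ ρ := by rw [← h1]; rfl
  refine ⟨eV, heV, hρ, ?_, ?_, ?_, ?_, ?_, ?_⟩
  · intro u w lam
    have h := third_chart_apply_grad_eq_zero_of_isSemisimple eV e ρ hρ hC3 h47 u w lam
    rw [hchart] at h
    exact h
  · intro l u w
    have h := hessian_chart_ad_invariant_of_isSemisimple eV e ρ hρ hC3 h47 l u w
    rw [hchart] at h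
    exact h
  · intro u₁ u₂ u₃ lam
    have h := fourth_chart_apply_grad_eq_zero_of_bracket e ρ (h2 4 hC4) lam (h47 lam) (fun a b => eV.symm ⁅eV a, eV b⁆) hρ u₁ u₂ u₃
    rw [hchart] at h
    exact h
  · intro x lam hlam δ c B hδ hc hB
    have h := eq429_chart_of_isSemisimple eV e ρ hρ (h2 4 hC4) h47 x lam hlam δ c B hδ hc hB
    rw [hchart] at h
    exact h
  · intro x lam hlam δ c B ℓ hδ hc hB
    have h := eq431_chart_of_isSemisimple eV e ρ hρ hC3 h47 x lam hlam δ c B ℓ hδ hc hB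
    rw [hchart] at h
    exact h
  · obtain ⟨E, hE⟩ := Literature.MathematicalPhysics.QuantumFieldTheory.Balaban1983to89.B12Schur433.hessian_chart_eq_sum_scalar_kernel_killing eV e ρ hρ hC3 h47
      (fun φ hφ => Literature.MathematicalPhysics.QuantumFieldTheory.Balaban1983to89.B12Schur433.exists_eq_smul_of_centroid_of_killing_neg
        (fun _ hx => Literature.Algebra.Lie.CompactKillingForm.killingForm_su_apply_self_neg hx) φ hφ)
    refine ⟨E, fun u w => ?_⟩
    have h := hE u w
    rw [hchart] at h
    exact h

end Generic

/-! ## §2 At the re-centred record -/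

section Record

open Literature.MathematicalPhysics.QuantumFieldTheory.Balaban1983to89.Node00
open Literature.MathematicalPhysics.QuantumFieldTheory.Balaban1983to89.ExpMeanLog (deltaSU)
open Literature.MathematicalPhysics.QuantumFieldTheory.GawedzkiKupiainen1985.PeriodicGleason (unitVec)
open T4Continuum (T4Family)
open Summit.QuantumFields.YangMills.Theorems.K0RecordFormatNames
open FederbushMean (deltaFed)
open GaugeField (gaugeAct)

variable (F : T4Family) (a₀ ε₂₉ : ℝ)

/-- **The record's `hN` row ⟹ the generic `SU(2)`-invariance shape for `ℰ := recordTermsAx … K`**: if `𝓝_{k+1}(W^w) = 𝓝_{k+1}(W)` for every lattice gauge transformation `w` and every `ε₁`-small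
`W`, then near `1` every `SU(2)`-valued ambient configuration read through `suOfMat` is invariant under `SU(2)`-valued `g` (the block inside FILE `…Sect4AmbientExtension`'s record proof, named).
[cite: Balaban1987RG1, (1.19) p.263, (2.16) p.269, (4.7) p.282] -/
theorem suGaugeInvariant_recordTermsAx_of_hN (k : ℕ) (v : Fin (k + 1) → ℝ) (K : ℕ) {ε₁ : ℝ} (hε₁ : 0 < ε₁)
    (hN : letI θ := thetaFill F a₀ ε₂₉
      ∀ (w : GaugeTransf (F.P K) (k + 1) (SU 2)) (W : GaugeField (F.P K) (k + 1) (SU 2)), PlaqSmall ε₁ W →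
        mergedTermT F 2 (TβOfRecord₁₃ F 2) (chiβOfRecord₁₃Ax F 2 θ) θ.εbg K (T4FlagMemory.extd v) k (gaugeAct w W) =
          mergedTermT F 2 (TβOfRecord₁₃ F 2) (chiβOfRecord₁₃Ax F 2 θ) θ.εbg K (T4FlagMemory.extd v) k W) :
    ∀ᶠ Vf in 𝓝 (1 : Fin (F.P K).d → Site (F.P K) (k + 1) → MatA 2), (∀ ν x, Vf ν x ∈ Matrix.specialUnitaryGroup (Fin 2) ℂ) →
      ∀ g : Site (F.P K) (k + 1) → MatA 2, (∀ x, g x ∈ Matrix.specialUnitaryGroup (Fin 2) ℂ) →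
        recordTermsAx F a₀ ε₂₉ k v K (fun ν x => g x * Vf ν x * star (g (x + siteOfInt F K (k + 1) (unitVec (Fin.cast (F.P_d K) ν))))) =
          recordTermsAx F a₀ ε₂₉ k v K Vf := by
  letI θ := thetaFill F a₀ ε₂₉
  filter_upwards [eventually_plaqSmall_readField F k K hε₁] with Vf hVf hSU g hg
  have hread : ∀ b : PBond (F.P K) (k + 1), readField F 2 (suOfMat 2) Vf b = ⟨Vf b.dir b.src, hSU b.dir b.src⟩ := fun b => suOfMat_of_mem (hSU b.dir b.src)
  have hmemg : ∀ ν x, g x * Vf ν x * star (g (x + siteOfInt F K (k + 1) (unitVec (Fin.cast (F.P_d K) ν)))) ∈ Matrix.specialUnitaryGroup (Fin 2) ℂ := fun ν x =>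
    Submonoid.mul_mem _ (Submonoid.mul_mem _ (hg x) (hSU ν x)) (by rw [← Matrix.specialUnitaryGroup.coe_star ⟨_, hg _⟩]; exact (star (⟨_, hg _⟩ : SU 2)).2)
  have hW : readField F 2 (suOfMat 2) (fun ν x => g x * Vf ν x * star (g (x + siteOfInt F K (k + 1) (unitVec (Fin.cast (F.P_d K) ν))))) =
      gaugeAct (fun x => (⟨g x, hg x⟩ : SU 2)) (readField F 2 (suOfMat 2) Vf) := by
    funext b
    apply Subtype.ext
    show ((suOfMat 2 (g b.src * Vf b.dir b.src * star (g (b.src + siteOfInt F K (k + 1) (unitVec (Fin.cast (F.P_d K) b.dir))))) : SU 2) : MatA 2) =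
      g b.src * ((readField F 2 (suOfMat 2) Vf b : SU 2) : MatA 2) * star (g (b.src.shift b.dir))
    rw [suOfMat_of_mem (hmemg b.dir b.src), hread]
    show g b.src * Vf b.dir b.src * star (g (b.src + siteOfInt F K (k + 1) (unitVec (Fin.cast (F.P_d K) b.dir)))) = g b.src * Vf b.dir b.src * star (g (b.src.shift b.dir))
    rw [add_siteOfInt_unitVec_eq_shift]
  show mergedTermT F 2 (TβOfRecord₁₃ F 2) (chiβOfRecord₁₃Ax F 2 θ) θ.εbg K (T4FlagMemory.extd v) k
      (readField F 2 (suOfMat 2) (fun ν x => g x * Vf ν x * star (g (x + siteOfInt F K (k + 1) (unitVec (Fin.cast (F.P_d K) ν)))))) =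
    mergedTermT F 2 (TβOfRecord₁₃ F 2) (chiβOfRecord₁₃Ax F 2 θ) θ.εbg K (T4FlagMemory.extd v) k (readField F 2 (suOfMat 2) Vf)
  rw [hW]
  exact hN _ _ (hVf hSU)

-- (the quadruply nested operator space over the iterated `Pi` type: one more level of pending instance synthesis)
set_option maxSynthPendingDepth 3 in
/-- **★★★ THE ONE-NAME §4 PACKAGE AT THE RE-CENTRED RECORD, VOLUME `K`** — (4.15)₂, p. 289 `Ad`-invariance, (4.15)₃, (4.29) EXACT, (4.31) EXACT and the scalar-kernel Hessian for the record's chart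
`B ↦ 𝓝_{k+1}(exp ρ₈B)` UNDER ONE TRANSPORT `eV` (all brackets the same object), from `C⁴` of the chart at `0` and the on-domain lattice gauge invariance `hN` of `𝓝_{k+1}` on `ε₁`-small fields —
`wardPackage_of_suGaugeInvariant` at `ρ₈ = suChartMap 2`, `ℰ := recordTermsAx … K`, `hGI` from `suGaugeInvariant_recordTermsAx_of_hN`.
[cite: Balaban1987RG1, (4.15) p.284, (4.29) p.288, (4.31) p.289, (4.32)-(4.34) p.289, (1.19) p.263, (2.16) p.269] -/
theorem sect4_recordTermsAx_package (k : ℕ) (v : Fin (k + 1) → ℝ) (K : ℕ) {ε₁ : ℝ} (hε₁ : 0 < ε₁)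
    (hC4 : letI θ := thetaFill F a₀ ε₂₉
      letI := θ.instVβ₁; letI := θ.instVβ₂
      ContDiffAt ℝ 4 (expChart (recordTermsAx F a₀ ε₂₉ k v K) θ.ρ8) 0)
    (hN : letI θ := thetaFill F a₀ ε₂₉
      ∀ (w : GaugeTransf (F.P K) (k + 1) (SU 2)) (W : GaugeField (F.P K) (k + 1) (SU 2)), PlaqSmall ε₁ W →
        mergedTermT F 2 (TβOfRecord₁₃ F 2) (chiβOfRecord₁₃Ax F 2 θ) θ.εbg K (T4FlagMemory.extd v) k (gaugeAct w W) =
          mergedTermT F 2 (TβOfRecord₁₃ F 2) (chiβOfRecord₁₃Ax F 2 θ) θ.εbg K (T4FlagMemory.extd v) k W) :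
    letI θ := thetaFill F a₀ ε₂₉
    letI := θ.instVβ₁; letI := θ.instVβ₂
    ∃ eV : θ.Vβ ≃ₗ[ℝ] su (Fin 2), (∀ a, ((eV a : su (Fin 2)) : Matrix (Fin 2) (Fin 2) ℂ) = θ.ρ8 a) ∧
      (∀ a b : θ.Vβ, θ.ρ8 (eV.symm ⁅eV a, eV b⁆) = θ.ρ8 a * θ.ρ8 b - θ.ρ8 b * θ.ρ8 a) ∧
      -- (4.15)₂
      (∀ (u w : recordW F a₀ ε₂₉ k K) (lam : Site (F.P K) (k + 1) → θ.Vβ),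
        fderiv ℝ (fderiv ℝ (fderiv ℝ (expChart (recordTermsAx F a₀ ε₂₉ k v K) θ.ρ8))) 0 u w (fun ν y => lam (y + siteOfInt F K (k + 1) (unitVec (Fin.cast (F.P_d K) ν))) - lam y)
          - fderiv ℝ (fderiv ℝ (expChart (recordTermsAx F a₀ ε₂₉ k v K) θ.ρ8)) 0 u
              (fun ν x => eV.symm ⁅eV (lam x), eV (w ν x)⁆ - (2 : ℝ)⁻¹ • eV.symm ⁅eV (w ν x), eV (lam (x + siteOfInt F K (k + 1) (unitVec (Fin.cast (F.P_d K) ν))) - lam x)⁆)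
          - fderiv ℝ (fderiv ℝ (expChart (recordTermsAx F a₀ ε₂₉ k v K) θ.ρ8)) 0 w
              (fun ν x => eV.symm ⁅eV (lam x), eV (u ν x)⁆ - (2 : ℝ)⁻¹ • eV.symm ⁅eV (u ν x), eV (lam (x + siteOfInt F K (k + 1) (unitVec (Fin.cast (F.P_d K) ν))) - lam x)⁆) = 0) ∧
      -- p. 289 `Ad`-invariance
      (∀ (l : θ.Vβ) (u w : recordW F a₀ ε₂₉ k K),
        fderiv ℝ (fderiv ℝ (expChart (recordTermsAx F a₀ ε₂₉ k v K) θ.ρ8)) 0 u (fun ν x => eV.symm ⁅eV l, eV (w ν x)⁆) +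
          fderiv ℝ (fderiv ℝ (expChart (recordTermsAx F a₀ ε₂₉ k v K) θ.ρ8)) 0 w (fun ν x => eV.symm ⁅eV l, eV (u ν x)⁆) = 0) ∧
      -- (4.15)₃
      (∀ (u₁ u₂ u₃ : recordW F a₀ ε₂₉ k K) (lam : Site (F.P K) (k + 1) → θ.Vβ),
        fderiv ℝ (fderiv ℝ (fderiv ℝ (fderiv ℝ (expChart (recordTermsAx F a₀ ε₂₉ k v K) θ.ρ8)))) 0 u₁ u₂ u₃ (fun ν y => lam (y + siteOfInt F K (k + 1) (unitVec (Fin.cast (F.P_d K) ν))) - lam y)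
          - fderiv ℝ (fderiv ℝ (fderiv ℝ (expChart (recordTermsAx F a₀ ε₂₉ k v K) θ.ρ8))) 0 u₁ u₂
              (fun ν x => eV.symm ⁅eV (lam x), eV (u₃ ν x)⁆ - (2 : ℝ)⁻¹ • eV.symm ⁅eV (u₃ ν x), eV (lam (x + siteOfInt F K (k + 1) (unitVec (Fin.cast (F.P_d K) ν))) - lam x)⁆)
          - fderiv ℝ (fderiv ℝ (fderiv ℝ (expChart (recordTermsAx F a₀ ε₂₉ k v K) θ.ρ8))) 0 u₁ u₃
              (fun ν x => eV.symm ⁅eV (lam x), eV (u₂ ν x)⁆ - (2 : ℝ)⁻¹ • eV.symm ⁅eV (u₂ ν x), eV (lam (x + siteOfInt F K (k + 1) (unitVec (Fin.cast (F.P_d K) ν))) - lam x)⁆)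
          - fderiv ℝ (fderiv ℝ (fderiv ℝ (expChart (recordTermsAx F a₀ ε₂₉ k v K) θ.ρ8))) 0 u₂ u₃
              (fun ν x => eV.symm ⁅eV (lam x), eV (u₁ ν x)⁆ - (2 : ℝ)⁻¹ • eV.symm ⁅eV (u₁ ν x), eV (lam (x + siteOfInt F K (k + 1) (unitVec (Fin.cast (F.P_d K) ν))) - lam x)⁆)
          + fderiv ℝ (fderiv ℝ (expChart (recordTermsAx F a₀ ε₂₉ k v K) θ.ρ8)) 0 u₁
              (fun ν x => (12 : ℝ)⁻¹ • (eV.symm ⁅eV (u₂ ν x), eV (eV.symm ⁅eV (u₃ ν x), eV (lam (x + siteOfInt F K (k + 1) (unitVec (Fin.cast (F.P_d K) ν))) - lam x)⁆)⁆ +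
                eV.symm ⁅eV (u₃ ν x), eV (eV.symm ⁅eV (u₂ ν x), eV (lam (x + siteOfInt F K (k + 1) (unitVec (Fin.cast (F.P_d K) ν))) - lam x)⁆)⁆))
          + fderiv ℝ (fderiv ℝ (expChart (recordTermsAx F a₀ ε₂₉ k v K) θ.ρ8)) 0 u₂
              (fun ν x => (12 : ℝ)⁻¹ • (eV.symm ⁅eV (u₁ ν x), eV (eV.symm ⁅eV (u₃ ν x), eV (lam (x + siteOfInt F K (k + 1) (unitVec (Fin.cast (F.P_d K) ν))) - lam x)⁆)⁆ +
                eV.symm ⁅eV (u₃ ν x), eV (eV.symm ⁅eV (u₁ ν x), eV (lam (x + siteOfInt F K (k + 1) (unitVec (Fin.cast (F.P_d K) ν))) - lam x)⁆)⁆))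
          + fderiv ℝ (fderiv ℝ (expChart (recordTermsAx F a₀ ε₂₉ k v K) θ.ρ8)) 0 u₃
              (fun ν x => (12 : ℝ)⁻¹ • (eV.symm ⁅eV (u₁ ν x), eV (eV.symm ⁅eV (u₂ ν x), eV (lam (x + siteOfInt F K (k + 1) (unitVec (Fin.cast (F.P_d K) ν))) - lam x)⁆)⁆ +
                eV.symm ⁅eV (u₂ ν x), eV (eV.symm ⁅eV (u₁ ν x), eV (lam (x + siteOfInt F K (k + 1) (unitVec (Fin.cast (F.P_d K) ν))) - lam x)⁆)⁆)) = 0) ∧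
      -- (4.29) EXACT
      (∀ (x : Site (F.P K) (k + 1)) (lam : Site (F.P K) (k + 1) → θ.Vβ), lam x = 0 → ∀ (δ c B : recordW F a₀ ε₂₉ k K),
        (∀ ν y, y ≠ x → δ ν y = 0) → (∀ ν y, lam (y + siteOfInt F K (k + 1) (unitVec (Fin.cast (F.P_d K) ν))) - lam y = c ν y) → (∀ ν, B ν x = c ν x) →
        fderiv ℝ (fderiv ℝ (fderiv ℝ (fderiv ℝ (expChart (recordTermsAx F a₀ ε₂₉ k v K) θ.ρ8)))) 0 δ B B B =
          (2 : ℝ) • fderiv ℝ (fderiv ℝ (expChart (recordTermsAx F a₀ ε₂₉ k v K) θ.ρ8)) 0 δ (fun ν y => eV.symm ⁅eV (lam y), eV (eV.symm ⁅eV (lam y), eV (c ν y)⁆)⁆)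
          - fderiv ℝ (fderiv ℝ (expChart (recordTermsAx F a₀ ε₂₉ k v K) θ.ρ8)) 0 δ (fun ν y => eV.symm ⁅eV (eV.symm ⁅eV (lam y), eV (c ν y)⁆), eV (c ν y)⁆)
          - (3 / 2 : ℝ) • fderiv ℝ (fderiv ℝ (expChart (recordTermsAx F a₀ ε₂₉ k v K) θ.ρ8)) 0 (fun ν y => eV.symm ⁅eV (δ ν y), eV (B ν y)⁆) (fun ν y => eV.symm ⁅eV (lam y), eV (c ν y)⁆)
          + (fderiv ℝ (fderiv ℝ (fderiv ℝ (fderiv ℝ (expChart (recordTermsAx F a₀ ε₂₉ k v K) θ.ρ8)))) 0 δ B B (B - c)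
            - (2 : ℝ) • fderiv ℝ (fderiv ℝ (expChart (recordTermsAx F a₀ ε₂₉ k v K) θ.ρ8)) 0
                (fun ν y => (12 : ℝ)⁻¹ • (eV.symm ⁅eV (B ν y), eV (eV.symm ⁅eV (δ ν y), eV (c ν y)⁆)⁆ + eV.symm ⁅eV (δ ν y), eV (eV.symm ⁅eV (B ν y), eV (c ν y)⁆)⁆)) (B - c)
            - (2 : ℝ) • fderiv ℝ (fderiv ℝ (expChart (recordTermsAx F a₀ ε₂₉ k v K) θ.ρ8)) 0 δ (fun ν y => (12 : ℝ)⁻¹ • eV.symm ⁅eV (B ν y), eV (eV.symm ⁅eV (B ν y - c ν y), eV (c ν y)⁆)⁆)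
            - (2 : ℝ)⁻¹ • fderiv ℝ (fderiv ℝ (fderiv ℝ (expChart (recordTermsAx F a₀ ε₂₉ k v K) θ.ρ8))) 0 (fun ν y => eV.symm ⁅eV (δ ν y), eV (B ν y)⁆) B (B - c)
            + (4 : ℝ)⁻¹ • fderiv ℝ (fderiv ℝ (expChart (recordTermsAx F a₀ ε₂₉ k v K) θ.ρ8)) 0 (fun ν y => eV.symm ⁅eV (δ ν y), eV (B ν y)⁆) (fun ν y => eV.symm ⁅eV (B ν y - c ν y), eV (c ν y)⁆)
            + (4 : ℝ)⁻¹ • fderiv ℝ (fderiv ℝ (expChart (recordTermsAx F a₀ ε₂₉ k v K) θ.ρ8)) 0 (fun ν y => eV.symm ⁅eV (eV.symm ⁅eV (δ ν y), eV (B ν y)⁆), eV (B ν y)⁆) (B - c)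
            - fderiv ℝ (fderiv ℝ (fderiv ℝ (expChart (recordTermsAx F a₀ ε₂₉ k v K) θ.ρ8))) 0 δ B (fun ν y => eV.symm ⁅eV (B ν y - c ν y), eV (c ν y)⁆)
            + (2 : ℝ) • fderiv ℝ (fderiv ℝ (fderiv ℝ (expChart (recordTermsAx F a₀ ε₂₉ k v K) θ.ρ8))) 0 δ (fun ν y => eV.symm ⁅eV (lam y), eV (B ν y)⁆) (B - c)
            + (2 : ℝ) • fderiv ℝ (fderiv ℝ (expChart (recordTermsAx F a₀ ε₂₉ k v K) θ.ρ8)) 0 δ (fun ν y => eV.symm ⁅eV (lam y), eV (eV.symm ⁅eV (lam y), eV (B ν y - c ν y)⁆)⁆)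
            - fderiv ℝ (fderiv ℝ (expChart (recordTermsAx F a₀ ε₂₉ k v K) θ.ρ8)) 0 δ (fun ν y => eV.symm ⁅eV (eV.symm ⁅eV (lam y), eV (B ν y - c ν y)⁆), eV (c ν y)⁆)
            - (3 / 2 : ℝ) • fderiv ℝ (fderiv ℝ (expChart (recordTermsAx F a₀ ε₂₉ k v K) θ.ρ8)) 0 (fun ν y => eV.symm ⁅eV (δ ν y), eV (B ν y)⁆) (fun ν y => eV.symm ⁅eV (lam y), eV (B ν y - c ν y)⁆))) ∧
      -- (4.31) EXACT
      (∀ (x : Site (F.P K) (k + 1)) (lam : Site (F.P K) (k + 1) → θ.Vβ), lam x = 0 → ∀ (δ c B ℓ : recordW F a₀ ε₂₉ k K),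
        (∀ ν y, y ≠ x → δ ν y = 0) → (∀ ν y, lam (y + siteOfInt F K (k + 1) (unitVec (Fin.cast (F.P_d K) ν))) - lam y = c ν y) → (∀ ν, B ν x = c ν x) →
        fderiv ℝ (fderiv ℝ (fderiv ℝ (expChart (recordTermsAx F a₀ ε₂₉ k v K) θ.ρ8))) 0 δ B B =
          fderiv ℝ (fderiv ℝ (expChart (recordTermsAx F a₀ ε₂₉ k v K) θ.ρ8)) 0 δ (fun ν y => eV.symm ⁅eV (lam y), eV (c ν y)⁆)
          + (2 : ℝ) • fderiv ℝ (fderiv ℝ (expChart (recordTermsAx F a₀ ε₂₉ k v K) θ.ρ8)) 0 δ (fun ν y => eV.symm ⁅eV (lam y), eV (ℓ ν y)⁆)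
          - fderiv ℝ (fderiv ℝ (expChart (recordTermsAx F a₀ ε₂₉ k v K) θ.ρ8)) 0 δ (fun ν y => eV.symm ⁅eV (ℓ ν y), eV (c ν y)⁆)
          - fderiv ℝ (fderiv ℝ (expChart (recordTermsAx F a₀ ε₂₉ k v K) θ.ρ8)) 0 (fun ν y => eV.symm ⁅eV (δ ν y), eV (B ν y)⁆) ℓ
          + (fderiv ℝ (fderiv ℝ (fderiv ℝ (expChart (recordTermsAx F a₀ ε₂₉ k v K) θ.ρ8))) 0 δ B (B - c - ℓ)
            + fderiv ℝ (fderiv ℝ (fderiv ℝ (expChart (recordTermsAx F a₀ ε₂₉ k v K) θ.ρ8))) 0 δ ℓ ℓ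
            + fderiv ℝ (fderiv ℝ (fderiv ℝ (expChart (recordTermsAx F a₀ ε₂₉ k v K) θ.ρ8))) 0 δ (B - c - ℓ) ℓ
            - (2 : ℝ)⁻¹ • fderiv ℝ (fderiv ℝ (expChart (recordTermsAx F a₀ ε₂₉ k v K) θ.ρ8)) 0 (fun ν y => eV.symm ⁅eV (δ ν y), eV (B ν y)⁆) (B - c - ℓ)
            + fderiv ℝ (fderiv ℝ (expChart (recordTermsAx F a₀ ε₂₉ k v K) θ.ρ8)) 0 δ (fun ν y => eV.symm ⁅eV (lam y), eV (B ν y - c ν y - ℓ ν y)⁆)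
            - (2 : ℝ)⁻¹ • fderiv ℝ (fderiv ℝ (expChart (recordTermsAx F a₀ ε₂₉ k v K) θ.ρ8)) 0 δ (fun ν y => eV.symm ⁅eV (B ν y - c ν y - ℓ ν y), eV (c ν y)⁆))) ∧
      -- (4.32)–(4.34): one scalar kernel
      (∃ E : Fin (F.P K).d → Site (F.P K) (k + 1) → Fin (F.P K).d → Site (F.P K) (k + 1) → ℝ, ∀ u w : recordW F a₀ ε₂₉ k K,
        fderiv ℝ (fderiv ℝ (expChart (recordTermsAx F a₀ ε₂₉ k v K) θ.ρ8)) 0 u w = ∑ μ, ∑ x, ∑ ν, ∑ y, killingForm ℝ (su (Fin 2)) (eV (u μ x)) (eV (w ν y)) • E μ x ν y) := by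
  letI θ := thetaFill F a₀ ε₂₉; letI := θ.instVβ₁; letI := θ.instVβ₂
  have hρ : (θ.ρ8 : θ.Vβ → MatA 2) = (suChartMap 2 : (Fin (suChartDim 2) → ℝ) → MatA 2) := rfl
  have hinj : Function.Injective θ.ρ8 := fun a b h => suChartMap_injective 2 (by rw [← congrFun hρ a, ← congrFun hρ b]; exact h)
  exact wardPackage_of_suGaugeInvariant θ.ρ8 hinj (fun a => by rw [congrFun hρ a]; exact suChartMap_mem 2 a)
    (fun X h1 h2 => by obtain ⟨a, ha⟩ := suChartMap_onto 2 X h1 h2; exact ⟨a, by rw [congrFun hρ a]; exact ha⟩)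
    (recordTermsAx F a₀ ε₂₉ k v K) (fun ν => siteOfInt F K (k + 1) (unitVec (Fin.cast (F.P_d K) ν))) hC4
    (suGaugeInvariant_recordTermsAx_of_hN F a₀ ε₂₉ k v K hε₁ hN)

end Record

end Summit.QuantumFields.YangMills.Theorems.BalabanUVNodesPortS1

end
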